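import Mathlib
import HarnessLib

/-!
# Gap arithmetic for the "parallel weights" conclusion of route `NonParallelVoid`

Every item of route `Langlands/NonParallelVoid` (Target, EmptyWeightCore, TwistedInductionParallel,
TensorSquareParallel, LocallyReducibleParallel, ResidueParallel) concludes
`∃ g : ℤ, ∀ (label), ∃ a : ℤ, HT_label = {a, a + g}` from hypotheses `HT_label = {a, b}`, `a < b`, where the
`HT_label : Multiset ℤ` are two-element multisets of labelled Hodge–Tate weights.  This file isolates the
pure multiset/integer arithmetic of that conclusion, used by the line `inert-fl-transfer` of crux
`ResidueParallel` (stmt-Langlands-17003) and reusable by every prover of the route: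

* `pair_eq_pair_iff` — `{x, y} = {a, b} ↔ (x = a ∧ y = b) ∨ (x = b ∧ y = a)` for 2-element multisets;
* `gap_eq_of_common_gap` — if `{x, x + g} = {a, b}` and `{x', x' + g} = {a', b'}` with `a < b`, `a' < b'`,
  then `b - a = b' - a'` (a common `g`, of either sign, forces EQUAL gaps: the conclusion is sign-blind but
  has content);
* `even_gapSum_of_common_gap` — a common `g` forces an EVEN gap sum `(b - a) + (b' - a')` (no ordering
  hypothesis), so the odd-gap-sum cells of the route (`TensorSquareParallel`, `EmptyWeightCore`, stubs
  `stub_tensorUnramifiedFL` / `stub_emptyWeightUnramifiedFL`) assert that their hypotheses are contradictory;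
* `exists_pair_eq_of_gap_eq` — conversely, equal gaps give the common-`g` normal form (with `g` the gap).

No number theory is involved; these are the bookkeeping lemmas between "gaps equal" and the typed conclusion.
-/

-- `Summit.Langlands.Langlands.…`: summit = sub-problem name (D-0017 nested layout), the mandated namespace.
set_option linter.dupNamespace false

namespace Summit.Langlands.Langlands.Theorems.NonParallelVoid

/-- Two 2-element multisets of integers `{x, y}` and `{a, b}` are equal iff their entries agree up to order.
[folklore] -/
theorem pair_eq_pair_iff {x y a b : ℤ} :
    ({x, y} : Multiset ℤ) = {a, b} ↔ (x = a ∧ y = b) ∨ (x = b ∧ y = a) := by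
  constructor
  · intro h
    simp only [Multiset.insert_eq_cons] at h
    rw [Multiset.cons_eq_cons] at h
    simp only [Multiset.singleton_inj, Multiset.singleton_eq_cons_iff, ne_eq] at h
    rcases h with ⟨h1, h2⟩ | ⟨-, cs, ⟨h1, -⟩, ⟨h2, -⟩⟩
    · exact Or.inl ⟨h1, h2⟩
    · exact Or.inr ⟨h2.symm, h1⟩
  · rintro (⟨h1, h2⟩ | ⟨h1, h2⟩)
    · rw [h1, h2]
    · rw [h1, h2, Multiset.pair_comm]

/-- If `{x, x + g} = {a, b}` as multisets then `g = b - a` or `g = a - b`. [folklore] -/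
theorem gap_eq_or_eq_neg_of_pair_eq {x g a b : ℤ} (h : ({x, x + g} : Multiset ℤ) = {a, b}) :
    g = b - a ∨ g = a - b := by
  rcases pair_eq_pair_iff.1 h with ⟨h1, h2⟩ | ⟨h1, h2⟩
  · left; omega
  · right; omega

/-- **A common `g` forces equal gaps.**  If `{x, x + g} = {a, b}` and `{x', x' + g} = {a', b'}` with `a < b`
and `a' < b'`, then `b - a = b' - a'`: the route's conclusion `∃ g, ∀ label, ∃ a, HT = {a, a + g}` says exactly
that all labelled gaps are equal (the sign of `g` is immaterial). [folklore] -/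
theorem gap_eq_of_common_gap {x x' g a b a' b' : ℤ} (hab : a < b) (hab' : a' < b')
    (h : ({x, x + g} : Multiset ℤ) = {a, b}) (h' : ({x', x' + g} : Multiset ℤ) = {a', b'}) :
    b - a = b' - a' := by
  rcases gap_eq_or_eq_neg_of_pair_eq h with h1 | h1 <;>
    rcases gap_eq_or_eq_neg_of_pair_eq h' with h2 | h2 <;> omega

/-- **A common `g` forces an even gap sum** (no ordering hypothesis): if `{x, x + g} = {a, b}` and
`{x', x' + g} = {a', b'}` then `(b - a) + (b' - a')` is even.  Hence a pair of labels with ODD gap sum refutes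
the parallel-weights conclusion, i.e. the odd-gap-sum items of the route assert the emptiness of their
hypotheses. [folklore] -/
theorem even_gapSum_of_common_gap {x x' g a b a' b' : ℤ}
    (h : ({x, x + g} : Multiset ℤ) = {a, b}) (h' : ({x', x' + g} : Multiset ℤ) = {a', b'}) :
    Even (b - a + (b' - a')) := by
  rw [Int.even_iff]
  rcases gap_eq_or_eq_neg_of_pair_eq h with h1 | h1 <;>
    rcases gap_eq_or_eq_neg_of_pair_eq h' with h2 | h2 <;> omega

/-- The refutation packaged: an odd gap-sum pair of labels admits no common `g`. [folklore] -/
theorem not_common_gap_of_odd_gapSum {x x' g a b a' b' : ℤ} (hodd : ¬ Even (b - a + (b' - a')))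
    (h : ({x, x + g} : Multiset ℤ) = {a, b}) (h' : ({x', x' + g} : Multiset ℤ) = {a', b'}) : False :=
  hodd (even_gapSum_of_common_gap h h')

/-- **Equal gaps give the normal form**: if `b - a = g` then `{a, b} = {x, x + g}` with `x = a`. [folklore] -/
theorem exists_pair_eq_of_gap_eq {a b g : ℤ} (h : b - a = g) :
    ∃ x : ℤ, ({a, b} : Multiset ℤ) = {x, x + g} :=
  ⟨a, by rw [show b = a + g by omega]⟩

/-- Normal form from a family of gap equalities: if every member of a family of 2-element weight data
`(a i, b i)` has the same gap `g`, the family is in the route's concluded shape. [folklore] -/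
theorem forall_exists_pair_eq_of_gap_eq {ι : Sort*} {a b : ι → ℤ} {g : ℤ} (h : ∀ i, b i - a i = g) :
    ∀ i, ∃ x : ℤ, ({a i, b i} : Multiset ℤ) = {x, x + g} :=
  fun i => exists_pair_eq_of_gap_eq (h i)

/-- **Reduction of the route's conclusion to "all gaps are equal"**, in the exact dependent shape of the
route items: labels are pairs `(v, τ)` with `v` ranging over the places satisfying `P v` (intended:
`(p : 𝓞 F) ∈ v.asIdeal`) and `τ : T v hv` (intended: the `ℚ_p`-algebra embeddings `F_v →ₐ[ℚ_p] ℚ̄_p` for the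
datum-supplied algebra structure, which depends on `hv`), and `HT v hv τ : Multiset ℤ` the labelled weights.
If every label carries two weights `{a, b}`, `a < b` (hypothesis `hHT` of every item) and any two labels have
the same gap, then there is one `g` with every `HT = {a, a + g}`.  (If there is no label at all the conclusion
is vacuous.)  Use: after `intro`ducing an item's binders, `refine exists_common_gap_of_forall_gap_eq _ hHT ?_`
leaves the genuine obligation `gap = gap'`. [folklore] -/
theorem exists_common_gap_of_forall_gap_eq {V : Type*} {P : V → Prop} {T : ∀ v : V, P v → Sort*}
    (HT : ∀ (v : V) (hv : P v), T v hv → Multiset ℤ)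
    (hHT : ∀ (v : V) (hv : P v) (τ : T v hv), ∃ a b : ℤ, a < b ∧ HT v hv τ = {a, b})
    (hgap : ∀ (v : V) (hv : P v) (τ : T v hv) (w : V) (hw : P w) (σ : T w hw) (a b a' b' : ℤ),
      HT v hv τ = {a, b} → a < b → HT w hw σ = {a', b'} → a' < b' → b - a = b' - a') :
    ∃ g : ℤ, ∀ (v : V) (hv : P v) (τ : T v hv), ∃ a : ℤ, HT v hv τ = {a, a + g} := by
  by_cases hlab : ∃ (v : V) (hv : P v), Nonempty (T v hv)
  · obtain ⟨v₀, hv₀, ⟨τ₀⟩⟩ := hlab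
    obtain ⟨a₀, b₀, hab₀, h₀⟩ := hHT v₀ hv₀ τ₀
    refine ⟨b₀ - a₀, fun v hv τ => ?_⟩
    obtain ⟨a, b, hab, h⟩ := hHT v hv τ
    obtain ⟨x, hx⟩ := exists_pair_eq_of_gap_eq (hgap v hv τ v₀ hv₀ τ₀ a b a₀ b₀ h hab h₀ hab₀)
    exact ⟨x, h.trans hx⟩
  · refine ⟨0, fun v hv τ => ?_⟩
    exact absurd ⟨v, hv, ⟨τ⟩⟩ hlab

/-- **Converse bookkeeping**: a common `g` as in the route's conclusion gives equal gaps at any two labels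
carrying regular weight pairs. [folklore] -/
theorem forall_gap_eq_of_exists_common_gap {V : Type*} {P : V → Prop} {T : ∀ v : V, P v → Sort*}
    (HT : ∀ (v : V) (hv : P v), T v hv → Multiset ℤ)
    (hpar : ∃ g : ℤ, ∀ (v : V) (hv : P v) (τ : T v hv), ∃ a : ℤ, HT v hv τ = {a, a + g}) :
    ∀ (v : V) (hv : P v) (τ : T v hv) (w : V) (hw : P w) (σ : T w hw) (a b a' b' : ℤ),
      HT v hv τ = {a, b} → a < b → HT w hw σ = {a', b'} → a' < b' → b - a = b' - a' := by
  obtain ⟨g, hg⟩ := hpar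
  intro v hv τ w hw σ a b a' b' h hab h' hab'
  obtain ⟨x, hx⟩ := hg v hv τ
  obtain ⟨x', hx'⟩ := hg w hw σ
  exact gap_eq_of_common_gap hab hab' (hx.symm.trans h) (hx'.symm.trans h')

/-- In particular the route's conclusion forces an EVEN gap sum at every pair of labels (the typed form of
"odd gap sum ⇒ the item asserts emptiness"). [folklore] -/
theorem forall_even_gapSum_of_exists_common_gap {V : Type*} {P : V → Prop} {T : ∀ v : V, P v → Sort*}
    (HT : ∀ (v : V) (hv : P v), T v hv → Multiset ℤ)
    (hpar : ∃ g : ℤ, ∀ (v : V) (hv : P v) (τ : T v hv), ∃ a : ℤ, HT v hv τ = {a, a + g}) :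
    ∀ (v : V) (hv : P v) (τ : T v hv) (w : V) (hw : P w) (σ : T w hw) (a b a' b' : ℤ),
      HT v hv τ = {a, b} → HT w hw σ = {a', b'} → Even (b - a + (b' - a')) := by
  obtain ⟨g, hg⟩ := hpar
  intro v hv τ w hw σ a b a' b' h h'
  obtain ⟨x, hx⟩ := hg v hv τ
  obtain ⟨x', hx'⟩ := hg w hw σ
  exact even_gapSum_of_common_gap (hx.symm.trans h) (hx'.symm.trans h')

end Summit.Langlands.Langlands.Theorems.NonParallelVoid
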